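import Summits.QuantumFields.BalabanUV.T4Continuum.Support.BlockAverageLoopFlux
import Summits.QuantumFields.BalabanUV.T4Continuum.Support.AveragingDeficitLiftDefectSum
import HarnessLib

/-!
# YM-DAG node N16 (NE3), the located averaging pin (42) ↔ (0.4) — part 7: THE BLOCK-CENTRING PART OF THE PIN ON LIPSCHITZ-FLUX FIELDS —
# an offset stencil's first-order exponent is its FIRST-MOMENT value up to `(2(dL + |s|₁) + L)·(dL + |s|₁)·L·δ`; the CENTRED stencil's exponent is
# `O(d²L³δ)` with NO `O(L²·flux)` term; corner − centred = [first-moment 1-form at the base point] + `O(L³δ)`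

Cell `pub-ymgap`, width seat `pub-ymgap-dag-n16-w3` (director-ym №197 ∕ HUMAN RULING D-0149), generation 2; part 7 of the W1b sequel (part 6
`…StencilFirstMoment`: the EXACT constant-curvature values).  `--kind proof --supports stmt-QuantumFields-20544 --as helper` (K3⁷; count-neutral; 0 def).

THE POINT.  Part 6 computed, at CONSTANT flux, the first-order exponent of the block average with stencil `{q − s + r : r ∈ [0,L)ᵈ}` exactly:
`L·Σ_m((L−1)∕2 − s_m)·f_m` (corner (42): `(L(L−1)∕2)Σf`; centred (0.4): `0`).  Here the flux is only `Δ`-close to a reference value `f_m` on the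
relevant neighbourhood (`‖A(∂p)_x(m,κ) − f_m‖ ≤ Δ` for `|x − q|₁ ≤ 2(dL + |s|₁) + L`; a `δ`-Lipschitz flux gives `Δ = δ·(2(dL+|s|₁)+L)` with `f_m` the value
at `q`), and the same telescoping gives BOUNDS (no definition, no Stokes beyond the tree's one-rectangle formula):
 * §1 `norm_rectSum_sub_le` · `norm_segDiff_natCast_sub_le` · `norm_segDiff_sub_le`: a signed segment against its `Le_κ`-translate is within `|z|·L·Δ` of
   `(zL)•f` (plus the exactly telescoping straight-segment terms);
 * §2 ★ `norm_loop_sub_le`: for every `v ∈ ℤᵈ`, `‖A(Γ_{c,q+v} ∪ −Γ_c) − Σ_m (v_mL)•f_m‖ ≤ |v|₁·L·Δ`;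
 * §3 ★★ `norm_stencil_sub_moment_le`: `‖[offset-s exponent](q,κ) − Σ_m L((L−1)∕2 − s_m)•f_m‖ ≤ (dL + |s|₁)·L·Δ`; ★★ `norm_centred_le` (`L = 2M+1`,
   `s = M·𝟙`): `‖[centred exponent](q,κ)‖ ≤ (dL + dM)·L·Δ` — the CENTRED stencil of (0.4) carries NO first-order `O(L²·flux)` term, only the Lipschitz
   remainder `O(d²L³δ)`, whereas (42)'s exponent is `(L(L−1)∕2)Σ_m f_m + O(d²L³δ)` (`norm_corner_sub_moment_le`, the tree's `norm_Xhat_sub_const_flux_le`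
   up to constants); ★ `norm_corner_sub_stencil_sub_le`: `‖(X̂ − [offset-s exponent]) − Σ_m (L s_m)•f_m‖ ≤ (2dL + |s|₁)·L·Δ` — corner minus centred is the
   FIRST-MOMENT 1-FORM at the base point (part 6: an exact gradient when `f` is constant) up to `O(L³δ)`.

READING FOR N16 (honest).  With parts 1–6: the located pin (42) ↔ (0.4) (p584628) decomposes at first order, on a level-`j` field of [B11]-Thm-1 TYPE
regularity (flux `bη²`, flux Lipschitz constant `cη³`), into [permutation symmetrisation: `O(d²L³cη³)` — parts 1–5] + [block centring: the first-moment 1-form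
`(L(L−1)∕2)Σ_m F_{mκ}(q) = O(dL²bη²)`, which is a pure gauge at constant curvature (part 6) and deviates from its base-point value by `O(d²L³cη³)` (part 7)].
What is NOT typed: that the `q`-dependent first-moment 1-form is a gauge up to `O(L³δ)` in a precise cohomological sense (its lattice curl is a first difference
of `F`); and anything about minimisers ∕ the Transfer Props.

HONEST FRAMING.  [folklore] finite-sum bookkeeping over `B7Prop1Explicit` (`stokes`, `asum_rectWord`, `asum_seg_neg`) and `BlockAverageLoopFlux` (`upper`,
`asum_treeWord_upper_succ`, `asum_loop_eq`, `sum_boxCoord`, `l1_upper_le`) and `AveragingDeficitLiftDefectSum.natAbs_le_l1` BY NAME; 0 `def`, 0 `sorry`; nothing of [Balaban1985Averaging] ∕ [Balaban1987RG1]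
asserted beyond what the tree proves; no minimiser; `stub_h7` NOT closed; N16 ∕ NE3 NOT discharged; count-neutral (typed 28∕28 · discharged 5∕27 unmoved).  One
finite four-torus programme at fixed `ε` — the Yang–Mills mass gap (Clay) is NOT proved by any of this; R4 closes the conditional finite-𝕋⁴ rung `BalabanLadder.UV`
only; nothing continuum ∕ ℝ⁴ ∕ OS.
-/

set_option autoImplicit false

open scoped BigOperators
open NormedSpace Finset

namespace Summit.QuantumFields.YangMills.BalabanUVNodes.N16Eq42StencilLipschitz

open Literature.MathematicalPhysics.QuantumFieldTheory.Balaban1983to89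
open B7Prop1Explicit
open Summit.QuantumFields.BalabanUV.T4Continuum.BlockAverageLoopFlux (upper upper_zero upper_of_le upper_succ_add asum_treeWord_upper_succ
  asum_loop_eq sum_boxCoord l1_upper_le)
open Summit.QuantumFields.BalabanUV.T4Continuum.AveragingDeficitLiftDefectSum (natAbs_le_l1)

noncomputable section

variable {d : ℕ}
variable {𝔸 : Type*} [NormedRing 𝔸]

/-! ## §1 One signed segment against its `L e_κ`-translate, flux `Δ`-close to a reference value -/

/-- A rectangle sum of `n·L` plaquette circulations each within `Δ` of `f` is within `n·L·Δ` of `(nL)•f`. [folklore] -/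
theorem norm_rectSum_sub_le (A : Site d → Fin d → 𝔸) (p : Site d) (m κ : Fin d) (n L : ℕ) (f : 𝔸) {Δ : ℝ}
    (hdev : ∀ i < n, ∀ j < L, ‖asum A (p + (i : ℤ) • e m + (j : ℤ) • e κ) (plaqWord m κ) - f‖ ≤ Δ) :
    ‖(∑ i ∈ Finset.range n, ∑ j ∈ Finset.range L, asum A (p + (i : ℤ) • e m + (j : ℤ) • e κ) (plaqWord m κ)) - ((n * L : ℕ) : ℤ) • f‖
      ≤ n * L * Δ := by
  have hrew : (∑ i ∈ Finset.range n, ∑ j ∈ Finset.range L, asum A (p + (i : ℤ) • e m + (j : ℤ) • e κ) (plaqWord m κ)) - ((n * L : ℕ) : ℤ) • f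
      = ∑ i ∈ Finset.range n, ∑ j ∈ Finset.range L, (asum A (p + (i : ℤ) • e m + (j : ℤ) • e κ) (plaqWord m κ) - f) := by
    rw [natCast_zsmul]
    simp only [Finset.sum_sub_distrib, Finset.sum_const, Finset.card_range, smul_smul]
  rw [hrew]
  calc ‖∑ i ∈ Finset.range n, ∑ j ∈ Finset.range L, (asum A (p + (i : ℤ) • e m + (j : ℤ) • e κ) (plaqWord m κ) - f)‖
      ≤ ∑ i ∈ Finset.range n, ∑ j ∈ Finset.range L, ‖asum A (p + (i : ℤ) • e m + (j : ℤ) • e κ) (plaqWord m κ) - f‖ :=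
        (norm_sum_le _ _).trans (Finset.sum_le_sum fun i _ => norm_sum_le _ _)
    _ ≤ ∑ i ∈ Finset.range n, ∑ _j ∈ Finset.range L, Δ :=
        Finset.sum_le_sum fun i hi => Finset.sum_le_sum fun j hj => hdev i (Finset.mem_range.mp hi) j (Finset.mem_range.mp hj)
    _ = n * L * Δ := by rw [Finset.sum_const, Finset.sum_const, Finset.card_range, Finset.card_range, nsmul_eq_mul, nsmul_eq_mul]; ring

/-- **FORWARD SEGMENT**: `‖A([p,p+ne_m]) − A([p+Le_κ,·]) + (g(p+ne_m) − g(p)) − (nL)•f‖ ≤ n·L·Δ` when the flux in the plane `(m,κ)` is within `Δ` of `f` on the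
`n × L` rectangle at `p` (`g(y) = A([y, y+Le_κ])`; tree `stokes` + `asum_rectWord`). [folklore] -/
theorem norm_segDiff_natCast_sub_le (L : ℕ) (A : Site d → Fin d → 𝔸) (m κ : Fin d) (f : 𝔸) (p : Site d) (n : ℕ) {Δ : ℝ}
    (hdev : ∀ i < n, ∀ j < L, ‖asum A (p + (i : ℤ) • e m + (j : ℤ) • e κ) (plaqWord m κ) - f‖ ≤ Δ) :
    ‖asum A p (seg m n) - asum A (p + (L : ℤ) • e κ) (seg m n)
        + (asum A (p + (n : ℤ) • e m) (seg κ L) - asum A p (seg κ L)) - ((n * L : ℕ) : ℤ) • f‖ ≤ n * L * Δ := by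
  have hS := stokes A p n L m κ
  rw [asum_rectWord] at hS
  have : asum A p (seg m n) - asum A (p + (L : ℤ) • e κ) (seg m n) + (asum A (p + (n : ℤ) • e m) (seg κ L) - asum A p (seg κ L))
      = asum A p (seg m n) + asum A (p + (n : ℤ) • e m) (seg κ L) - asum A (p + (L : ℤ) • e κ) (seg m n) - asum A p (seg κ L) := by abel
  rw [this, hS]
  exact norm_rectSum_sub_le A p m κ n L f hdev

/-- **SIGNED SEGMENT**: for every `z ∈ ℤ`, `‖A(seg m z from p) − A(seg m z from p+Le_κ) + (g(p+ze_m) − g(p)) − (zL)•f‖ ≤ |z|·L·Δ` when the flux is within `Δ` of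
`f` at every base point within `|·|₁`-distance `|z| + L` of `p` (both orientations' rectangles). [folklore] -/
theorem norm_segDiff_sub_le (L : ℕ) (A : Site d → Fin d → 𝔸) (m κ : Fin d) (f : 𝔸) (p : Site d) {Δ : ℝ} (z : ℤ)
    (hdev : ∀ x : Site d, l1 (x - p) ≤ z.natAbs + L → ‖asum A x (plaqWord m κ) - f‖ ≤ Δ) :
    ‖asum A p (seg m z) - asum A (p + (L : ℤ) • e κ) (seg m z)
        + (asum A (p + z • e m) (seg κ L) - asum A p (seg κ L)) - (z * L) • f‖ ≤ z.natAbs * L * Δ := by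
  -- distance bookkeeping for a point `p + a•e m + j•e κ`
  have hdist : ∀ (a : ℤ) (j : ℕ), j < L → a.natAbs ≤ z.natAbs →
      l1 (p + a • e m + (j : ℤ) • e κ - p) ≤ z.natAbs + L := by
    intro a j hj ha
    rw [show p + a • e m + (j : ℤ) • e κ - p = a • e m + (j : ℤ) • e κ by abel]
    refine (l1_add_le _ _).trans ?_
    rw [l1_zsmul_e, l1_zsmul_e, Int.natAbs_natCast]
    omega
  rcases Int.eq_nat_or_neg z with ⟨n, rfl | rfl⟩
  · -- forward
    have h := norm_segDiff_natCast_sub_le L A m κ f p n (Δ := Δ) fun i hi j hj =>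
      hdev _ (hdist i j hj (by simp only [Int.natAbs_natCast]; omega))
    have hz : ((n : ℤ) * L) • f = ((n * L : ℕ) : ℤ) • f := by push_cast; rfl
    rw [hz, Int.natAbs_natCast]
    simpa using h
  · -- backward: reduce to the forward rectangle based at `p − n e_m`
    rw [asum_seg_neg, asum_seg_neg,
      show p + (L : ℤ) • e κ - (n : ℤ) • e m = (p - (n : ℤ) • e m) + (L : ℤ) • e κ by abel,
      show p + -(n : ℤ) • e m = p - (n : ℤ) • e m by rw [neg_smul, sub_eq_add_neg]]
    have h := norm_segDiff_natCast_sub_le L A m κ f (p - (n : ℤ) • e m) n (Δ := Δ) fun i hi j hj => by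
      refine hdev _ ?_
      rw [show p - (n : ℤ) • e m + (i : ℤ) • e m + (j : ℤ) • e κ = p + ((i : ℤ) - n) • e m + (j : ℤ) • e κ by rw [sub_smul]; abel]
      exact hdist _ j hj (by simp only [Int.natAbs_neg, Int.natAbs_natCast]; omega)
    rw [show p - (n : ℤ) • e m + (n : ℤ) • e m = p by abel] at h
    have hz : (-(n : ℤ) * L) • f = -(((n * L : ℕ) : ℤ) • f) := by rw [neg_mul, neg_smul]; push_cast; rfl
    rw [hz, Int.natAbs_neg, Int.natAbs_natCast]
    have key : -asum A (p - (n : ℤ) • e m) (seg m n) - -asum A (p - (n : ℤ) • e m + (L : ℤ) • e κ) (seg m n)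
        + (asum A (p - (n : ℤ) • e m) (seg κ L) - asum A p (seg κ L)) - -(((n * L : ℕ) : ℤ) • f)
        = -(asum A (p - (n : ℤ) • e m) (seg m n) - asum A (p - (n : ℤ) • e m + (L : ℤ) • e κ) (seg m n)
            + (asum A p (seg κ L) - asum A (p - (n : ℤ) • e m) (seg κ L)) - ((n * L : ℕ) : ℤ) • f) := by abel
    rw [key, norm_neg]
    exact h

/-! ## §2 The (42)-loop at a signed offset: within `|v|₁·L·Δ` of the first-moment value -/

/-- The points met along the way stay within `2|v|₁ + L` of `q`. [folklore] -/
theorem l1_seg_point_le (q : Site d) (v : Site d) (m : Fin d) (x : Site d) {R : ℕ}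
    (hx : l1 (x - (q + upper ((m : ℕ) + 1) v)) ≤ R) : l1 (x - q) ≤ l1 v + R := by
  have h := l1_add_le (upper ((m : ℕ) + 1) v) (x - (q + upper ((m : ℕ) + 1) v))
  rw [show upper ((m : ℕ) + 1) v + (x - (q + upper ((m : ℕ) + 1) v)) = x - q by abel] at h
  exact h.trans (by have := l1_upper_le ((m : ℕ) + 1) v; omega)

/-- **★ THE (42)-LOOP AT A SIGNED OFFSET ON `Δ`-CLOSE FLUX**: if for every plane `(m, κ)` the circulations of `A` are within `Δ` of `f_m` at all base points within
`|·|₁`-distance `2|v|₁ + L` of `q`, then `‖A(Γ_{c,q+v} ∪ −Γ_c) − Σ_m (v_mL)•f_m‖ ≤ |v|₁·L·Δ` (telescoping along the signed tree contour with §1 on every segment;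
the straight-segment terms telescope away EXACTLY). [folklore] -/
theorem norm_loop_sub_le (L : ℕ) (A : Site d → Fin d → 𝔸) (q : Site d) (κ : Fin d) (f : Fin d → 𝔸) (v : Site d) {Δ : ℝ}
    (hdev : ∀ (m : Fin d) (x : Site d), l1 (x - q) ≤ 2 * l1 v + L → ‖asum A x (plaqWord m κ) - f m‖ ≤ Δ) :
    ‖asum A q (gammaWord L κ v ++ seg κ (-(L : ℤ))) - ∑ m : Fin d, (v m * L) • f m‖ ≤ l1 v * L * Δ := by
  -- the telescope of part 6, now with remainders
  set G : ℕ → 𝔸 := fun k =>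
    (asum A q (treeWord (upper k v)) - asum A (q + (L : ℤ) • e κ) (treeWord (upper k v)))
      + (asum A (q + upper k v) (seg κ L) - asum A q (seg κ L)) with hG
  have h0 : G 0 = asum A q (gammaWord L κ v ++ seg κ (-(L : ℤ))) := by
    rw [asum_loop_eq]; simp [hG]
  have hd : G d = 0 := by simp [hG, upper_of_le le_rfl]
  have hstep : ∀ m : Fin d, ‖(G m - G ((m : ℕ) + 1)) - (v m * L) • f m‖ ≤ (v m).natAbs * L * Δ := by
    intro m
    have hseg := norm_segDiff_sub_le L A m κ (f m) (q + upper ((m : ℕ) + 1) v) (Δ := Δ) (v m) fun x hx =>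
      hdev m x ((l1_seg_point_le q v m x hx).trans (by have := natAbs_le_l1 v m; omega))
    have hid : G m - G ((m : ℕ) + 1)
        = asum A (q + upper ((m : ℕ) + 1) v) (seg m (v m)) - asum A (q + upper ((m : ℕ) + 1) v + (L : ℤ) • e κ) (seg m (v m))
          + (asum A (q + upper ((m : ℕ) + 1) v + v m • e m) (seg κ L) - asum A (q + upper ((m : ℕ) + 1) v) (seg κ L)) := by
      simp only [hG]
      rw [asum_treeWord_upper_succ A q m v, asum_treeWord_upper_succ A (q + (L : ℤ) • e κ) m v, ← upper_succ_add m v,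
        show q + (L : ℤ) • e κ + upper ((m : ℕ) + 1) v = q + upper ((m : ℕ) + 1) v + (L : ℤ) • e κ by abel,
        show q + (upper ((m : ℕ) + 1) v + v m • e m) = q + upper ((m : ℕ) + 1) v + v m • e m by abel]
      abel
    rw [hid]
    exact hseg
  have htel : ∑ m ∈ Finset.range d, (G m - G (m + 1)) = G 0 - G d := Finset.sum_range_sub' G d
  have hsum : asum A q (gammaWord L κ v ++ seg κ (-(L : ℤ))) = ∑ m : Fin d, (G m - G ((m : ℕ) + 1)) := by
    rw [← h0, ← sub_zero (G 0), ← hd, ← htel, ← Fin.sum_univ_eq_sum_range (fun k => G k - G (k + 1)) d]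
  rw [hsum, ← Finset.sum_sub_distrib]
  calc ‖∑ m : Fin d, (G m - G ((m : ℕ) + 1) - (v m * L) • f m)‖
      ≤ ∑ m : Fin d, ‖G m - G ((m : ℕ) + 1) - (v m * L) • f m‖ := norm_sum_le _ _
    _ ≤ ∑ m : Fin d, ((v m).natAbs : ℝ) * L * Δ := Finset.sum_le_sum fun m _ => hstep m
    _ = l1 v * L * Δ := by
        rw [← Finset.sum_mul, ← Finset.sum_mul]
        congr 2
        unfold l1; push_cast; rfl

/-! ## §3 Stencils on `Δ`-close flux: first moment up to `O((dL+|s|₁)·L·Δ)` -/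

omit [NormedRing 𝔸] in
/-- Offsets of the stencil `{q − s + r}` have `|boxVec r − s|₁ ≤ dL + |s|₁`. [folklore] -/
theorem l1_boxVec_sub_le (L : ℕ) (r : Fin d → Fin L) (s : Site d) : l1 (boxVec L r - s) ≤ d * L + l1 s := by
  have h := l1_add_le (boxVec L r) (-s)
  rw [← sub_eq_add_neg, l1_neg] at h
  exact h.trans (by have := l1_boxVec_le L r; omega)

variable [NormedAlgebra ℂ 𝔸]

/-- The arithmetic of the first moment: `Σ_r L^{−d}•Σ_m ((r_m − s_m)L)•f_m = Σ_m L((L−1)∕2 − s_m)•f_m` (`sum_boxCoord`). [folklore] -/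
theorem mean_moment (L : ℕ) (hL : 1 ≤ L) (f : Fin d → 𝔸) (s : Site d) :
    ∑ r : Fin d → Fin L, (((L : ℝ) ^ d)⁻¹) • ∑ m : Fin d, ((boxVec L r - s) m * L) • f m
      = ∑ m : Fin d, ((L : ℝ) * (((L : ℝ) - 1) / 2 - (s m : ℝ))) • f m := by
  have hL0 : (0 : ℝ) < (L : ℝ) ^ d := pow_pos (by exact_mod_cast (by omega : 0 < L)) _
  simp_rw [Finset.smul_sum, Pi.sub_apply]
  rw [Finset.sum_comm]
  refine Finset.sum_congr rfl fun m _ => ?_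
  have hcast : ∀ r : Fin d → Fin L, (((L : ℝ) ^ d)⁻¹) • (((boxVec L r m - s m) * L) • f m)
      = ((((L : ℝ) ^ d)⁻¹) * ((((r m : ℕ) : ℝ) - (s m : ℝ)) * L)) • f m := by
    intro r
    rw [← Int.cast_smul_eq_zsmul ℝ, smul_smul]
    congr 1
    simp [boxVec]
  simp_rw [hcast]
  rw [← Finset.sum_smul]
  congr 1
  rw [← Finset.mul_sum, ← Finset.sum_mul, Finset.sum_sub_distrib, sum_boxCoord L m, Finset.sum_const, Finset.card_univ,
    Fintype.card_fun, Fintype.card_fin, Fintype.card_fin, nsmul_eq_mul]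
  push_cast
  field_simp

/-- **★★ THE OFFSET STENCIL ON `Δ`-CLOSE FLUX**: the first-order exponent of the block average with stencil `{q − s + r}` — the displayed sum
`Σ_r L^{−d}•A(Γ_{c,q−s+r} ∪ −Γ_c)` — is within `(dL + |s|₁)·L·Δ` of its FIRST-MOMENT value `Σ_m L((L−1)∕2 − s_m)•f_m`, when every circulation in the planes
`(m, κ)` within `|·|₁`-distance `2(dL + |s|₁) + L` of `q` is within `Δ` of `f_m`. [folklore] -/
theorem norm_stencil_sub_moment_le (L : ℕ) (hL : 1 ≤ L) (A : Site d → Fin d → 𝔸) (q : Site d) (κ : Fin d) (f : Fin d → 𝔸) (s : Site d)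
    {Δ : ℝ} (hΔ : 0 ≤ Δ)
    (hdev : ∀ (m : Fin d) (x : Site d), l1 (x - q) ≤ 2 * (d * L + l1 s) + L → ‖asum A x (plaqWord m κ) - f m‖ ≤ Δ) :
    ‖(∑ r : Fin d → Fin L, (((L : ℝ) ^ d)⁻¹) • asum A q (gammaWord L κ (boxVec L r - s) ++ seg κ (-(L : ℤ))))
        - ∑ m : Fin d, ((L : ℝ) * (((L : ℝ) - 1) / 2 - (s m : ℝ))) • f m‖ ≤ (d * L + l1 s) * L * Δ := by
  have hL0 : (0 : ℝ) < (L : ℝ) ^ d := pow_pos (by exact_mod_cast (by omega : 0 < L)) _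
  rw [← mean_moment L hL f s, ← Finset.sum_sub_distrib]
  have hterm : ∀ r : Fin d → Fin L,
      ‖asum A q (gammaWord L κ (boxVec L r - s) ++ seg κ (-(L : ℤ))) - ∑ m : Fin d, ((boxVec L r - s) m * L) • f m‖ ≤ (d * L + l1 s) * L * Δ := by
    intro r
    have hv := l1_boxVec_sub_le L r s
    have h := norm_loop_sub_le L A q κ f (boxVec L r - s) fun m x hx => hdev m x (hx.trans (by omega))
    refine h.trans ?_
    have : (l1 (boxVec L r - s) : ℝ) ≤ d * L + l1 s := by exact_mod_cast hv
    have hL' : (0 : ℝ) ≤ L := by positivity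
    exact mul_le_mul_of_nonneg_right (mul_le_mul_of_nonneg_right this hL') hΔ
  calc ‖∑ r : Fin d → Fin L, ((((L : ℝ) ^ d)⁻¹) • asum A q (gammaWord L κ (boxVec L r - s) ++ seg κ (-(L : ℤ)))
          - (((L : ℝ) ^ d)⁻¹) • ∑ m : Fin d, ((boxVec L r - s) m * L) • f m)‖
      ≤ ∑ r : Fin d → Fin L, ‖(((L : ℝ) ^ d)⁻¹) • asum A q (gammaWord L κ (boxVec L r - s) ++ seg κ (-(L : ℤ)))
          - (((L : ℝ) ^ d)⁻¹) • ∑ m : Fin d, ((boxVec L r - s) m * L) • f m‖ := norm_sum_le _ _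
    _ ≤ ∑ _r : Fin d → Fin L, ((L : ℝ) ^ d)⁻¹ * ((d * L + l1 s) * L * Δ) := Finset.sum_le_sum fun r _ => by
        rw [← smul_sub, norm_smul, norm_inv, Real.norm_of_nonneg hL0.le]
        exact mul_le_mul_of_nonneg_left (hterm r) (by positivity)
    _ = (d * L + l1 s) * L * Δ := by
        rw [Finset.sum_const, Finset.card_univ, Fintype.card_fun, Fintype.card_fin, Fintype.card_fin, nsmul_eq_mul]
        push_cast
        field_simp

/-- **★ CORNER BLOCK (42)**: `‖X̂ L A q κ − (L(L−1)∕2)•Σ_m f_m‖ ≤ dL·L·Δ` — the tree's `norm_Xhat_sub_const_flux_le` in the present bookkeeping (`s = 0`).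
[folklore] -/
theorem norm_corner_sub_moment_le (L : ℕ) (hL : 1 ≤ L) (A : Site d → Fin d → 𝔸) (q : Site d) (κ : Fin d) (f : Fin d → 𝔸) {Δ : ℝ} (hΔ : 0 ≤ Δ)
    (hdev : ∀ (m : Fin d) (x : Site d), l1 (x - q) ≤ 2 * (d * L) + L → ‖asum A x (plaqWord m κ) - f m‖ ≤ Δ) :
    ‖Xhat L A q κ - ∑ m : Fin d, ((L : ℝ) * (((L : ℝ) - 1) / 2)) • f m‖ ≤ (d * L) * L * Δ := by
  have h0 : l1 (0 : Site d) = 0 := by simp [l1]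
  have h := norm_stencil_sub_moment_le L hL A q κ f 0 hΔ (fun m x hx => hdev m x (by rw [h0] at hx; simpa using hx))
  rw [h0] at h
  simpa [Xhat] using h

/-- **★★ THE CENTRED STENCIL OF (0.4) HAS NO FIRST-ORDER `O(L²·flux)` TERM**: for `L = 2M+1` and `s = M·𝟙`,
`‖[centred exponent](q,κ)‖ ≤ (d(2M+1) + dM)·(2M+1)·Δ` — only the Lipschitz remainder survives (contrast (42): `(L(L−1)∕2)Σ_m f_m + remainder`).
[cite: Balaban1987RG1, p.252 («|n_μ| ≦ (L−1)/2»)] -/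
theorem norm_centred_le (M : ℕ) (A : Site d → Fin d → 𝔸) (q : Site d) (κ : Fin d) (f : Fin d → 𝔸) {Δ : ℝ} (hΔ : 0 ≤ Δ)
    (hdev : ∀ (m : Fin d) (x : Site d), l1 (x - q) ≤ 2 * (d * (2 * M + 1) + d * M) + (2 * M + 1) → ‖asum A x (plaqWord m κ) - f m‖ ≤ Δ) :
    ‖∑ r : Fin d → Fin (2 * M + 1), ((((2 * M + 1 : ℕ) : ℝ) ^ d)⁻¹) •
        asum A q (gammaWord (2 * M + 1) κ (boxVec (2 * M + 1) r - fun _ => (M : ℤ)) ++ seg κ (-((2 * M + 1 : ℕ) : ℤ)))‖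
      ≤ (d * (2 * M + 1) + d * M) * (2 * M + 1) * Δ := by
  have hl1 : l1 (fun _ : Fin d => (M : ℤ)) = d * M := by
    unfold l1; simp [Finset.sum_const, Finset.card_univ, Fintype.card_fin]
  have h := norm_stencil_sub_moment_le (2 * M + 1) (by omega) A q κ f (fun _ => (M : ℤ)) hΔ (by rw [hl1]; exact hdev)
  have hzero : ∑ m : Fin d, ((((2 * M + 1 : ℕ) : ℝ)) * (((((2 * M + 1 : ℕ) : ℝ)) - 1) / 2 - ((M : ℤ) : ℝ))) • f m = 0 := by
    refine Finset.sum_eq_zero fun m _ => ?_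
    have : (((((2 * M + 1 : ℕ) : ℝ)) - 1) / 2 - ((M : ℤ) : ℝ)) = 0 := by push_cast; ring
    rw [this, mul_zero, zero_smul]
  rw [hzero, sub_zero, hl1] at h
  exact_mod_cast h

/-- **★ CORNER MINUS OFFSET = THE FIRST-MOMENT 1-FORM AT THE BASE POINT, UP TO `O(L³δ)`**:
`‖(X̂ L A q κ − [offset-s exponent](q,κ)) − Σ_m (L s_m)•f_m‖ ≤ (2dL + |s|₁)·L·Δ`.  (Part 6: at constant curvature the difference IS `Σ_m (Ls_m)•f_m`, an exact
gradient; here `f_m` is the base-point value and the deviation is the Lipschitz remainder.) [folklore] -/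
theorem norm_corner_sub_stencil_sub_le (L : ℕ) (hL : 1 ≤ L) (A : Site d → Fin d → 𝔸) (q : Site d) (κ : Fin d) (f : Fin d → 𝔸) (s : Site d)
    {Δ : ℝ} (hΔ : 0 ≤ Δ)
    (hdev : ∀ (m : Fin d) (x : Site d), l1 (x - q) ≤ 2 * (d * L + l1 s) + L → ‖asum A x (plaqWord m κ) - f m‖ ≤ Δ) :
    ‖(Xhat L A q κ - ∑ r : Fin d → Fin L, (((L : ℝ) ^ d)⁻¹) • asum A q (gammaWord L κ (boxVec L r - s) ++ seg κ (-(L : ℤ))))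
        - ∑ m : Fin d, ((L : ℝ) * (s m : ℝ)) • f m‖ ≤ (2 * (d * L) + l1 s) * L * Δ := by
  have h1 := norm_corner_sub_moment_le L hL A q κ f hΔ fun m x hx => hdev m x (hx.trans (by omega))
  have h2 := norm_stencil_sub_moment_le L hL A q κ f s hΔ hdev
  have hsplit : ∑ m : Fin d, ((L : ℝ) * (s m : ℝ)) • f m
      = (∑ m : Fin d, ((L : ℝ) * (((L : ℝ) - 1) / 2)) • f m) - ∑ m : Fin d, ((L : ℝ) * (((L : ℝ) - 1) / 2 - (s m : ℝ))) • f m := by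
    rw [← Finset.sum_sub_distrib]
    refine Finset.sum_congr rfl fun m _ => ?_
    rw [← sub_smul]; congr 1; ring
  rw [hsplit]
  calc ‖(Xhat L A q κ - ∑ r : Fin d → Fin L, (((L : ℝ) ^ d)⁻¹) • asum A q (gammaWord L κ (boxVec L r - s) ++ seg κ (-(L : ℤ))))
          - ((∑ m : Fin d, ((L : ℝ) * (((L : ℝ) - 1) / 2)) • f m) - ∑ m : Fin d, ((L : ℝ) * (((L : ℝ) - 1) / 2 - (s m : ℝ))) • f m)‖
      = ‖(Xhat L A q κ - ∑ m : Fin d, ((L : ℝ) * (((L : ℝ) - 1) / 2)) • f m)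
          - ((∑ r : Fin d → Fin L, (((L : ℝ) ^ d)⁻¹) • asum A q (gammaWord L κ (boxVec L r - s) ++ seg κ (-(L : ℤ))))
              - ∑ m : Fin d, ((L : ℝ) * (((L : ℝ) - 1) / 2 - (s m : ℝ))) • f m)‖ := by congr 1; abel
    _ ≤ ‖Xhat L A q κ - ∑ m : Fin d, ((L : ℝ) * (((L : ℝ) - 1) / 2)) • f m‖
          + ‖(∑ r : Fin d → Fin L, (((L : ℝ) ^ d)⁻¹) • asum A q (gammaWord L κ (boxVec L r - s) ++ seg κ (-(L : ℤ))))
              - ∑ m : Fin d, ((L : ℝ) * (((L : ℝ) - 1) / 2 - (s m : ℝ))) • f m‖ := norm_sub_le _ _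
    _ ≤ (d * L) * L * Δ + (d * L + l1 s) * L * Δ := add_le_add h1 h2
    _ = (2 * (d * L) + l1 s) * L * Δ := by ring

end

end Summit.QuantumFields.YangMills.BalabanUVNodes.N16Eq42StencilLipschitz
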